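import Summits.RiemannHypothesis.RiemannHypothesis.Theorems.Splittings.ScrewGradedFloorDictionary
import Summits.RiemannHypothesis.RiemannHypothesis.Theorems.PfPersistenceHalfLineBiasSuzuki
import HarnessLib

/-!
# Splittings — the graded screw dictionary, ROW (C): one-sided graded CEILINGS of `Ψ`

`Ψ = zetaScrew` (Suzuki 2023 (1.1)).  The graded dictionary `ScrewGradedFloor` / `ScrewGradedFloorDictionary`
(cell rh-split, (screw, bridge) gen 9) proves, for every grade `η ≥ 0`, the RH-free equivalences
(Z) `QuasiRiemannHypothesis (1/2 + η)` ⟺ (F) graded FLOOR `∃ K, ∀ t ≥ 0, Ψ(t) ≥ -K e^{ηt}` ⟺ (A) two-sided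
⟺ (N) node floor.  This file books the missing mirror row

* (C) GRADED CEILING: `∃ K, ∀ t ≥ 0, Ψ(t) ≤ K e^{ηt}`,

`quasiRH_iff_exp_ceil : QuasiRiemannHypothesis (1/2 + η) ↔ (C)` (`η ≥ 0`), hence (F) ⟺ (C)
(`exp_floor_iff_exp_ceil`: a one-sided floor and a one-sided ceiling of the same grade detect the same strip), the RH
corollaries `rh_iff_ceil` (η = 0: RH ⟺ `Ψ` bounded above on `[0,∞)`, Suzuki 2023 Thm 1.6/1.7 read upward),
`rh_of_forall_exp_ceil` / `rh_iff_subexp_ceil` (RH ⟺ a sub-exponential ceiling for every `η > 0`), and the reusable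
DOUBLING-DEFECT helpers `ceil_dyadic` / `exists_poly_ceil_of_doublingDefect` / `exists_subexp_ceil_of_doublingDefect`
(a floor `Ψ(2t) ≤ 4Ψ(t) + K` of the doubling defect on `[0,∞)` iterates downward to a polynomial ceiling
`Ψ(t) ≤ C(1 + t²)`, hence to a graded ceiling for every `η > 0`).

TREE DEDUP (D-0014, typer's grep before typing): the detection half (C) ⟹ (Z) is NOT re-proved here — it is ALREADY a
tree theorem in the stronger EVENTUAL form, cell pub-rhpf CAND SEAT 7 gen 8,
`Theorems.PfPersistenceHalfLineBiasSuzuki.quasiRiemannHypothesis_of_zetaScrew_upper (hτ : 0 < τ)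
(hΨ : ∀ᶠ t in atTop, Ψ t ≤ A e^{τt}) : QuasiRiemannHypothesis (1/2 + τ)` (proof there: the half-line Chebyshev bias
`B` and Montgomery–Vaughan Thm 15.3, `quasiRiemannHypothesis_of_hlb_oneSided`), with the `τ = 0` ceiling
`riemannHypothesis_of_zetaScrew_eventually_le` and `zetaScrew_bddAbove_of_riemannHypothesis`; this file cites them BY
NAME (an independent Mellin–Landau mirror of `ScrewGradedFloor.gradedLandau` would be a second proof of a landed
statement).  The converse (Z) ⟹ (C) is the dictionary's zero side `ScrewGradedFloor.abs_zetaScrew_le_exp_of_strip`.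
The doubling-defect helpers are rh-idea-6 g3's REFERENCE bytes `L45_DyadicLandau_by_ceilRow.lean` (sha16
c0079643f4806763: `exists_ceil_Icc`, `ceil_dyadic`, `exists_poly_ceil`, `one_add_sq_le_exp`) carried VERBATIM into this
namespace (two `push_neg` ↦ `push Not` lint repairs); their corollary `CeilRow → ScrewSquaringLaw.DyadicLandau` is NOT
restated (item stmt-RiemannHypothesis-23894 is CLOSED·proved by prover-l41's own chain; from
`exists_subexp_ceil_of_doublingDefect` + `rh_of_forall_exp_ceil` it is two lines).

Cell rh-split, director-rh g12 (W2) 00:46:01Z / lead g9 RULING #405; filer rh-split-typer-1 g7; `--supports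
stmt-RiemannHypothesis-15757` (the family's item, as `ScrewGradedSparse` / `ScrewHittingFloor`).  HONEST LABEL: «zero-side
DICTIONARY ROW (C), by name from pub-rhpf's `quasiRiemannHypothesis_of_zetaScrew_upper`; TEST 0 / DEDUP INSTRUMENT (mirror
of member 0); NOT RH-free width; toward RH: 0.  A splitting A ∧ B ⟹ RH is CONDITIONAL bookkeeping unless A and B are both
proved; nothing here bears on the truth of RH.»  `Summit.RiemannHypothesis` is by definition Mathlib's `RiemannHypothesis`.
Zero `def`s; axioms standard.
-/

noncomputable section

set_option linter.dupNamespace false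

open Filter Topology Set

namespace Summit.RiemannHypothesis.RiemannHypothesis.Theorems.Splittings.ScrewGradedCeil

open Literature.NumberTheory.LFunctions
open Summit.RiemannHypothesis.RiemannHypothesis.Theorems.PfPersistenceHalfLineBiasSuzuki
  (quasiRiemannHypothesis_of_zetaScrew_upper riemannHypothesis_of_zetaScrew_eventually_le
    zetaScrew_bddAbove_of_riemannHypothesis)
open Summit.RiemannHypothesis.RiemannHypothesis.Theorems.Splittings.ScrewGradedFloor
  (abs_zetaScrew_le_exp_of_strip strip_of_quasiRH quasiRH_iff_exp_floor rh_of_forall_quasiRH)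

/-! ## 1. Row (C): graded ceilings detect the strip (by name from the tree) -/

/-- **(C) ⟹ (Z), `η > 0`:** a graded ceiling `Ψ(t) ≤ K e^{ηt}` on `[0, ∞)` gives `QuasiRiemannHypothesis (1/2 + η)`
— by name from `PfPersistenceHalfLineBiasSuzuki.quasiRiemannHypothesis_of_zetaScrew_upper` (which needs the
ceiling only eventually). -/
theorem quasiRH_of_exp_ceil {η K : ℝ} (hη : 0 < η)
    (h : ∀ t : ℝ, 0 ≤ t → zetaScrew t ≤ K * Real.exp (η * t)) :
    QuasiRiemannHypothesis (1 / 2 + η) :=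
  quasiRiemannHypothesis_of_zetaScrew_upper hη ((eventually_ge_atTop (0 : ℝ)).mono h)

/-- **(C) ⟹ RH at grade `η = 0`:** `Ψ` bounded above on `[0, ∞)` gives RH — by name from
`PfPersistenceHalfLineBiasSuzuki.riemannHypothesis_of_zetaScrew_eventually_le` (Suzuki 2023 Thm 1.6/1.7 read upward
through the half-line bias). -/
theorem rh_of_ceil {K : ℝ} (h : ∀ t : ℝ, 0 ≤ t → zetaScrew t ≤ K) : Summit.RiemannHypothesis :=
  riemannHypothesis_of_zetaScrew_eventually_le ((eventually_ge_atTop (0 : ℝ)).mono h)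

/-- **(C) ⟹ (Z) for every `η ≥ 0`** (at `η = 0`, `QuasiRiemannHypothesis (1/2)` is RH,
`quasiRiemannHypothesis_one_half_iff_holds`). -/
theorem quasiRH_of_exp_ceil_of_nonneg {η K : ℝ} (hη : 0 ≤ η)
    (h : ∀ t : ℝ, 0 ≤ t → zetaScrew t ≤ K * Real.exp (η * t)) :
    QuasiRiemannHypothesis (1 / 2 + η) := by
  rcases hη.eq_or_lt with h0 | hpos
  · subst h0
    rw [add_zero]
    refine quasiRiemannHypothesis_one_half_iff_holds.2 (rh_of_ceil (K := K) fun t ht ↦ ?_)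
    simpa using h t ht
  · exact quasiRH_of_exp_ceil hpos h

/-- **(Z) ⟹ (C), `η ≥ 0`:** a zero-free half-plane `Re s > 1/2 + η` gives a graded ceiling on `[0, ∞)` — the
dictionary's zero side `abs_zetaScrew_le_exp_of_strip` (two-sided bound `|Ψ(t)| ≤ S e^{η|t|}`) read upward. -/
theorem exp_ceil_of_quasiRH {η : ℝ} (hη : 0 ≤ η) (hq : QuasiRiemannHypothesis (1 / 2 + η)) :
    ∃ K : ℝ, ∀ t : ℝ, 0 ≤ t → zetaScrew t ≤ K * Real.exp (η * t) := by
  obtain ⟨S, _, hS⟩ := abs_zetaScrew_le_exp_of_strip hη (strip_of_quasiRH hq)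
  refine ⟨S, fun t ht ↦ ?_⟩
  have h := hS t
  rw [abs_of_nonneg ht] at h
  exact (abs_le.1 h).2

/-- **THE GRADED DICTIONARY, ROW (C): (Z) ⟺ (C)** (`η ≥ 0`): `QuasiRiemannHypothesis (1/2 + η)` iff `Ψ` has the
graded CEILING `Ψ(t) ≤ K e^{ηt}` on `[0, ∞)` — the mirror of `ScrewGradedFloor.quasiRH_iff_exp_floor`. -/
theorem quasiRH_iff_exp_ceil {η : ℝ} (hη : 0 ≤ η) :
    QuasiRiemannHypothesis (1 / 2 + η) ↔
      ∃ K : ℝ, ∀ t : ℝ, 0 ≤ t → zetaScrew t ≤ K * Real.exp (η * t) :=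
  ⟨exp_ceil_of_quasiRH hη, fun ⟨_, hK⟩ ↦ quasiRH_of_exp_ceil_of_nonneg hη hK⟩

/-- **(F) ⟺ (C)** (`η ≥ 0`): at every grade a one-sided FLOOR `-K e^{ηt} ≤ Ψ(t)` on `[0,∞)` exists iff a one-sided
CEILING `Ψ(t) ≤ K e^{ηt}` does — both are `QuasiRiemannHypothesis (1/2 + η)`. -/
theorem exp_floor_iff_exp_ceil {η : ℝ} (hη : 0 ≤ η) :
    (∃ K : ℝ, ∀ t : ℝ, 0 ≤ t → -K * Real.exp (η * t) ≤ zetaScrew t) ↔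
      ∃ K : ℝ, ∀ t : ℝ, 0 ≤ t → zetaScrew t ≤ K * Real.exp (η * t) :=
  (quasiRH_iff_exp_floor hη).symm.trans (quasiRH_iff_exp_ceil hη)

/-! ## 2. RH corollaries -/

/-- **RH ⟺ `Ψ` bounded above on `[0, ∞)`** (row (C) at `η = 0`; Suzuki 2023 Thm 1.6/1.7 upward; the eventual form is
the tree's `PfPersistenceHalfLineBiasSuzuki.riemannHypothesis_iff_zetaScrew_eventually_le`). -/
theorem rh_iff_ceil : Summit.RiemannHypothesis ↔ ∃ K : ℝ, ∀ t : ℝ, 0 ≤ t → zetaScrew t ≤ K :=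
  ⟨fun hRH ↦ (zetaScrew_bddAbove_of_riemannHypothesis hRH).imp fun _ hK t _ ↦ hK t,
    fun ⟨_, hK⟩ ↦ rh_of_ceil hK⟩

/-- **A graded ceiling for every `η > 0` ⟹ RH** (`QuasiRiemannHypothesis (1/2 + η)` for every `η > 0` is RH,
`ScrewGradedFloor.rh_of_forall_quasiRH`). -/
theorem rh_of_forall_exp_ceil
    (h : ∀ η : ℝ, 0 < η → ∃ K : ℝ, ∀ t : ℝ, 0 ≤ t → zetaScrew t ≤ K * Real.exp (η * t)) :
    Summit.RiemannHypothesis :=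
  rh_of_forall_quasiRH fun η hη ↦ (h η hη).elim fun _ hK ↦ quasiRH_of_exp_ceil hη hK

/-- **RH ⟺ SUB-EXPONENTIAL CEILING**: RH iff for every `η > 0`, `Ψ(t) ≤ K_η e^{ηt}` on `[0, ∞)` — the mirror of
`ScrewGradedFloor.rh_iff_subexp_floor` (under RH `Ψ` is even bounded, `zetaScrew_bddAbove_of_riemannHypothesis`). -/
theorem rh_iff_subexp_ceil :
    Summit.RiemannHypothesis ↔
      ∀ η : ℝ, 0 < η → ∃ K : ℝ, ∀ t : ℝ, 0 ≤ t → zetaScrew t ≤ K * Real.exp (η * t) := by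
  refine ⟨fun hRH η hη ↦ ?_, rh_of_forall_exp_ceil⟩
  obtain ⟨M, hM⟩ := zetaScrew_bddAbove_of_riemannHypothesis hRH
  refine ⟨|M|, fun t ht ↦ (hM t).trans ?_⟩
  exact (le_abs_self M).trans
    (le_mul_of_one_le_right (abs_nonneg M) (Real.one_le_exp (by positivity)))

/-! ## 3. The doubling defect: a floor of `Ψ(2t) - 4Ψ(t)` iterates down to a polynomial ceiling
(rh-idea-6 g3, `L45_DyadicLandau_by_ceilRow.lean` c0079643f4806763, verbatim) -/

/-- `Ψ` is bounded above on `[0, 2]` (continuity). -/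
theorem exists_ceil_Icc : ∃ M : ℝ, 0 ≤ M ∧ ∀ t ∈ Icc (0 : ℝ) 2, zetaScrew t ≤ M := by
  obtain ⟨M, hM⟩ := (isCompact_Icc (a := (0 : ℝ)) (b := 2)).exists_bound_of_continuousOn
    continuous_zetaScrew.continuousOn
  refine ⟨max M 0, le_max_right _ _, fun t ht ↦ ?_⟩
  have h := hM t ht
  rw [Real.norm_eq_abs] at h
  exact ((abs_le.1 h).2).trans (le_max_left _ _)

/-- **Downward iteration of the doubling-defect floor**: if `Ψ ≤ M` on `[0, 2]` and `Ψ(2t) ≤ 4Ψ(t) + K` for all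
`t ≥ 0`, then on `[0, 2^(n+1)]`, `Ψ ≤ 4^n (M + |K|) − |K|/3`. -/
theorem ceil_dyadic {K M : ℝ} (hM0 : 0 ≤ M) (hM : ∀ t ∈ Icc (0 : ℝ) 2, zetaScrew t ≤ M)
    (hK : ∀ t : ℝ, 0 ≤ t → zetaScrew (2 * t) ≤ 4 * zetaScrew t + K) :
    ∀ n : ℕ, ∀ t : ℝ, 0 ≤ t → t ≤ 2 ^ (n + 1) →
      zetaScrew t ≤ 4 ^ n * (M + |K|) - |K| / 3 := by
  intro n
  induction n with
  | zero =>
    intro t ht0 ht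
    have h := hM t ⟨ht0, by simpa using ht⟩
    have hK0 : 0 ≤ |K| := abs_nonneg K
    simp only [pow_zero, one_mul]
    linarith
  | succ n ih =>
    intro t ht0 ht
    by_cases hle : t ≤ 2 ^ (n + 1)
    · have h := ih t ht0 hle
      have h4 : (4 : ℝ) ^ n ≤ 4 ^ (n + 1) := pow_le_pow_right₀ (by norm_num) (Nat.le_succ n)
      have hMK : 0 ≤ M + |K| := by positivity
      nlinarith
    · push Not at hle
      have ht2 : t / 2 ≤ 2 ^ (n + 1) := by
        rw [div_le_iff₀ (by norm_num : (0 : ℝ) < 2)]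
        calc t ≤ 2 ^ (n + 1 + 1) := ht
          _ = 2 ^ (n + 1) * 2 := by ring
      have h := ih (t / 2) (by positivity) ht2
      have hstep := hK (t / 2) (by positivity)
      rw [show 2 * (t / 2) = t by ring] at hstep
      have hKabs : K ≤ |K| := le_abs_self K
      calc zetaScrew t ≤ 4 * zetaScrew (t / 2) + K := hstep
        _ ≤ 4 * (4 ^ n * (M + |K|) - |K| / 3) + |K| := by linarith
        _ = 4 ^ (n + 1) * (M + |K|) - |K| / 3 := by ring

/-- **Polynomial ceiling from the doubling-defect floor**: `Ψ(2t) ≤ 4Ψ(t) + K` on `[0, ∞)` gives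
`Ψ(t) ≤ C (1 + t²)` on `[0, ∞)` (`log₂ t` halvings, a factor `4` each: `4^{log₂ t} = t²`). -/
theorem exists_poly_ceil_of_doublingDefect {K : ℝ}
    (hK : ∀ t : ℝ, 0 ≤ t → zetaScrew (2 * t) ≤ 4 * zetaScrew t + K) :
    ∃ C : ℝ, 0 ≤ C ∧ ∀ t : ℝ, 0 ≤ t → zetaScrew t ≤ C * (1 + t ^ 2) := by
  obtain ⟨M, hM0, hM⟩ := exists_ceil_Icc
  refine ⟨M + |K|, by positivity, fun t ht0 ↦ ?_⟩
  have hMK : 0 ≤ M + |K| := by positivity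
  by_cases ht1 : t < 1
  · have h := hM t ⟨ht0, by linarith⟩
    have hK0 : 0 ≤ |K| := abs_nonneg K
    nlinarith
  · push Not at ht1
    obtain ⟨n, hn, hn'⟩ := exists_nat_pow_near ht1 (by norm_num : (1 : ℝ) < 2)
    have h := ceil_dyadic hM0 hM hK n t ht0 hn'.le
    have h4 : (4 : ℝ) ^ n = (2 ^ n) ^ 2 := by
      rw [← pow_mul, show (4 : ℝ) = 2 ^ 2 by norm_num, ← pow_mul, mul_comm]
    have h2n : (0 : ℝ) ≤ 2 ^ n := by positivity
    have hsq : ((2 : ℝ) ^ n) ^ 2 ≤ t ^ 2 := by nlinarith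
    have hK0 : 0 ≤ |K| := abs_nonneg K
    rw [h4] at h
    nlinarith

/-- `1 + t² ≤ (1 + 4/η²) e^{ηt}` for `t ≥ 0`, `η > 0` (from `e^{x} ≥ (1 + x/2)²`). -/
theorem one_add_sq_le_exp {η : ℝ} (hη : 0 < η) {t : ℝ} (ht : 0 ≤ t) :
    1 + t ^ 2 ≤ (1 + 4 / η ^ 2) * Real.exp (η * t) := by
  have h1 : 1 + η * t / 2 ≤ Real.exp (η * t / 2) := by
    have := Real.add_one_le_exp (η * t / 2); linarith
  have hpos : 0 ≤ 1 + η * t / 2 := by positivity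
  have h2 : (1 + η * t / 2) ^ 2 ≤ Real.exp (η * t) := by
    have : Real.exp (η * t) = Real.exp (η * t / 2) ^ 2 := by
      rw [sq, ← Real.exp_add]; ring_nf
    rw [this]
    exact pow_le_pow_left₀ hpos h1 2
  have h3 : 1 ≤ Real.exp (η * t) := Real.one_le_exp (by positivity)
  have h4 : η ^ 2 * t ^ 2 / 4 ≤ Real.exp (η * t) := by nlinarith
  have hη2 : 0 < η ^ 2 := by positivity
  have h5 : t ^ 2 ≤ 4 / η ^ 2 * Real.exp (η * t) := by
    rw [div_mul_eq_mul_div, le_div_iff₀ hη2]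
    nlinarith
  nlinarith

/-- **Sub-exponential ceilings from the doubling-defect floor**: `Ψ(2t) ≤ 4Ψ(t) + K` on `[0, ∞)` gives, for every
`η > 0`, a graded ceiling `Ψ(t) ≤ C (1 + 4/η²) e^{ηt}` on `[0, ∞)`.  (With `rh_of_forall_exp_ceil` this re-derives the
CLOSED item `ScrewSquaringLaw.DyadicLandau` (stmt-RiemannHypothesis-23894, prover-l41) in two lines; it is deliberately
NOT restated here.) -/
theorem exists_subexp_ceil_of_doublingDefect {K : ℝ}
    (hK : ∀ t : ℝ, 0 ≤ t → zetaScrew (2 * t) ≤ 4 * zetaScrew t + K) :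
    ∀ η : ℝ, 0 < η → ∃ C : ℝ, ∀ t : ℝ, 0 ≤ t → zetaScrew t ≤ C * Real.exp (η * t) := by
  intro η hη
  obtain ⟨C, hC0, hceil⟩ := exists_poly_ceil_of_doublingDefect hK
  refine ⟨C * (1 + 4 / η ^ 2), fun t ht ↦ ?_⟩
  calc zetaScrew t ≤ C * (1 + t ^ 2) := hceil t ht
    _ ≤ C * ((1 + 4 / η ^ 2) * Real.exp (η * t)) :=
        mul_le_mul_of_nonneg_left (one_add_sq_le_exp hη ht) hC0
    _ = C * (1 + 4 / η ^ 2) * Real.exp (η * t) := by ring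

/-- **The doubling-defect floor detects the strip at every grade**: `Ψ(2t) ≤ 4Ψ(t) + K` on `[0, ∞)` gives
`QuasiRiemannHypothesis (1/2 + η)` for every `η > 0` (row (C) applied to `exists_subexp_ceil_of_doublingDefect`). -/
theorem quasiRH_of_doublingDefect {K : ℝ}
    (hK : ∀ t : ℝ, 0 ≤ t → zetaScrew (2 * t) ≤ 4 * zetaScrew t + K) {η : ℝ} (hη : 0 < η) :
    QuasiRiemannHypothesis (1 / 2 + η) :=
  (exists_subexp_ceil_of_doublingDefect hK η hη).elim fun _ hC ↦ quasiRH_of_exp_ceil hη hC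

end Summit.RiemannHypothesis.RiemannHypothesis.Theorems.Splittings.ScrewGradedCeil

end
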